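import Summits.Ventures.Crystal3D.Theorems.StickyWulffConstantGenericWallFloorBarlowRowLineCount
import Summits.Ventures.Crystal3D.Theorems.StickyWulffConstantGenericWallFloorBarlowLineCount
import HarnessLib

/-!
# Row F4 in lane T's format, part 3: the mixed ROW | ZIGZAG corner — bottom «++» c-layer window ROWS and top zigzag window LINES
# are paid by the payers, `#T₃ + #T₂ ≤ Σ_PAY (12 − deg)` (crux `GenericWallFloor`, stmt-Ventures-19480, line `WallLedgerG`;
# lane T's row corner, cf-p1 DECISION (xxxvii⁗), wulff-p2 `…RowStripDefs` v3 / `bilayerWallRowCovFrom_of_lineCounts`)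

HONEST FRAMING. Venture `Summits/Ventures/Crystal3D` (cell `crystal3d-full`), helper `--supports` the crux `GenericWallFloor`
(stmt-Ventures-19480) of `route-Ventures-StickyWulffConstant`, registered line `WallLedgerG`, open stub `stub_twoSlabAdhesion`.
Rung credit only; F-C1 not moved; NOT the stub.  Inputs BY NAME: E1 (`ExactOnly`), `DoubleStarCoaxialAt` / `CapPairCoaxial`;
HYPOTHESES carried by the T-side glue: bottom rows steep for `e₃` (`RowSteep`), top zigzag walk data of `…BarlowPrefix` presented
with the layer index increasing downward (`axisSign` bookkeeping as in `barlow_lineCount_le_payers`), steps rising `≥ δ₂ > 0`, and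
the OFF-REGISTRY hypotheses for (row reach set of plate 1, zig reach set of plate 2).

Merge of `barlow_rowRowLines_le_payers` (row side: `rowSet_of_sites`, `rowLineFamily_spec`) and `barlow_lineCount_le_payers` (zig side:
`lineSet_of_sites`, `lineFamily_spec`), counted by `barlowRowZig_card_le_payers`; margin `m = 3 + (8/3)(h+4R₀) + 3/δ`, `δ = min δ₂ ½`.
* **`barlow_rowZigLines_le_payers`** — `∃ m ≥ 0, ∃ T₃ ⊇ {bottom «++» window rows at ρ−m}, T₂ ⊇ {top zig window lines at ρ−m},
  #T₃ + #T₂ ≤ Σ_PAY(12−deg)`.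
The other mixed corner (bottom zigzags, top rows) is the mirror statement (next file).
WHAT THIS IS NOT: not the T-side glue (weights, `36mρ ≤ C_w(1+h)ρ`, up-presentations); F-C1 not moved.
-/

noncomputable section

namespace Summit.Ventures.Crystal3D.Theorems

open Finset
open Literature.MathematicalPhysics.StatisticalMechanics
open Summit.Ventures.Crystal3D.Cruxes.TextureLiminf.TexShadow (stacking bestLayerDir)
open scoped InnerProductSpace

variable {X : Finset (EuclideanSpace ℝ (Fin 3))}

set_option maxHeartbeats 400000 in
open scoped Classical in
/-- **ROW | ZIGZAG in lane T's format.**  See the module docstring. -/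
theorem barlow_rowZigLines_le_payers (hX : ∀ p ∈ X, ∀ q ∈ X, p ≠ q → 1 ≤ dist p q)
    {sE : EuclideanSpace ℝ (Fin 3)} (hsE : sE ∈ fccSlots) (hcert : ExactOnly 0 (fccSlots.filter fun w => 0 < ⟪w, sE⟫_ℝ))
    (hDS : ∀ F₁ F₂ : EuclideanSpace ℝ (Fin 3) ≃ₗᵢ[ℝ] EuclideanSpace ℝ (Fin 3), DoubleStarCoaxialAt F₁ F₂) (hCP : CapPairCoaxial)
    -- the cell
    {σ₁ σ₂ : ℤ → ℤ} (hσ₁ : IsHaggSeq σ₁) (hσ₂ : IsHaggSeq σ₂)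
    (L₁ L₂ : EuclideanSpace ℝ (Fin 3) ≃ₗᵢ[ℝ] EuclideanSpace ℝ (Fin 3)) (s₀ s₂ : EuclideanSpace ℝ (Fin 3))
    (R₀ h ρ : ℝ) (hR₀ : 6 ≤ R₀) (hh : 0 ≤ h) (hρ : 1 ≤ ρ) (P₁ P₂ : Finset (EuclideanSpace ℝ (Fin 3))) (hP₁X : P₁ ⊆ X) (hP₂X : P₂ ⊆ X)
    (hcell : ∀ p ∈ X, -(2 * R₀) ≤ p 2 ∧ p 2 ≤ h + 2 * R₀ ∧ p 0 ^ 2 + p 1 ^ 2 ≤ ρ ^ 2)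
    (hP₁ : ∀ p, p ∈ P₁ ↔ (p ∈ stacking L₁ s₀ σ₁ ∧ -(2 * R₀) ≤ p 2 ∧ p 2 ≤ -R₀ ∧ p 0 ^ 2 + p 1 ^ 2 ≤ ρ ^ 2))
    (hP₂ : ∀ p, p ∈ P₂ ↔ (p ∈ stacking L₂ s₂ σ₂ ∧ h + R₀ ≤ p 2 ∧ p 2 ≤ h + 2 * R₀ ∧ p 0 ^ 2 + p 1 ^ 2 ≤ ρ ^ 2))
    -- bottom: steep rows
    (hsteep₁ : Real.sqrt 2 / 2 ≤ ⟪L₁ (bestLayerDir L₁ (EuclideanSpace.single (2 : Fin 3) (1 : ℝ))), EuclideanSpace.single (2 : Fin 3) (1 : ℝ)⟫_ℝ)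
    -- top: zigzag walk data (vertical −e₃)
    (v₂ : EuclideanSpace ℝ (Fin 3)) (canon₂ : ℤ → EuclideanSpace ℝ (Fin 3) → EuclideanSpace ℝ (Fin 3) × List WalkEntry)
    (ms₂ : ℤ → EuclideanSpace ℝ (Fin 3))
    (hv₂ : v₂ ∈ fccSlots) (hv₂2 : v₂ 2 = Real.sqrt (2 / 3))
    (hsteep₂ : Real.sqrt 2 / 2 ≤ ⟪L₂ v₂, -EuclideanSpace.single (2 : Fin 3) (1 : ℝ)⟫_ℝ)
    (hcanon₂₁ : ∀ m t, σ₂ (m - 1) = 1 → canon₂ m t = (t, [⟨L₂, v₂, 0⟩]))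
    (hcanon₂₂ : ∀ m t, σ₂ (m - 1) = -1 → canon₂ m t =
      (t, [⟨twinFrame L₂ (L₂ (EuclideanSpace.single (2 : Fin 3) (1 : ℝ))),
            bestCapper (twinFrame L₂ (L₂ (EuclideanSpace.single (2 : Fin 3) (1 : ℝ)))) (L₂ (EuclideanSpace.single (2 : Fin 3) (1 : ℝ)))
              (-EuclideanSpace.single (2 : Fin 3) (1 : ℝ)),
            L₂ (EuclideanSpace.single (2 : Fin 3) (1 : ℝ))⟩, ⟨L₂, v₂, 0⟩]))
    (hms₂₁ : ∀ m, σ₂ m = 1 → ms₂ m = v₂)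
    (hms₂₂ : ∀ m, σ₂ m = -1 → ms₂ m =
      basalMirror (bestCapper (twinFrame L₂ (L₂ (EuclideanSpace.single (2 : Fin 3) (1 : ℝ)))) (L₂ (EuclideanSpace.single (2 : Fin 3) (1 : ℝ)))
        (-EuclideanSpace.single (2 : Fin 3) (1 : ℝ))))
    {δ₂ : ℝ} (hδ₂0 : 0 < δ₂) (hδ₂ : ∀ m, δ₂ ≤ ⟪L₂ (ms₂ m), -EuclideanSpace.single (2 : Fin 3) (1 : ℝ)⟫_ℝ)
    (vertex₂ : ℤ → EuclideanSpace ℝ (Fin 3))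
    (hsucc₂ : ∀ k, vertex₂ (k + 1) = vertex₂ k + ms₂ k) (hlayer₂ : ∀ k, vertex₂ k ∈ barlowLayer 1 (Real.sqrt (2 / 3)) σ₂ k)
    -- off-registry (row reach set of plate 1, zig reach set of plate 2)
    (hoff₁ : ∀ y ∈ reachSet L₁ (L₁ ((haggLabel σ₁ 0 : ℝ) • barlowOffset 1) + s₀)
      (insert (twinFrame L₁ (L₁ (EuclideanSpace.single (2 : Fin 3) (1 : ℝ))))
        (chainFrames (EuclideanSpace.single (2 : Fin 3) (1 : ℝ)) L₁ (bestLayerDir L₁ (EuclideanSpace.single (2 : Fin 3) (1 : ℝ))))),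
      y ∉ stacking L₂ s₂ σ₂)
    (hoff₂ : ∀ y ∈ reachSet L₂ (L₂ ((haggLabel σ₂ 0 : ℝ) • barlowOffset 1) + s₂) (chainFrames (-EuclideanSpace.single (2 : Fin 3) (1 : ℝ)) L₂ v₂),
      y ∉ stacking L₁ s₀ σ₁)
    (hdisjR : ∀ y ∈ reachSet L₁ (L₁ ((haggLabel σ₁ 0 : ℝ) • barlowOffset 1) + s₀)
      (insert (twinFrame L₁ (L₁ (EuclideanSpace.single (2 : Fin 3) (1 : ℝ))))
        (chainFrames (EuclideanSpace.single (2 : Fin 3) (1 : ℝ)) L₁ (bestLayerDir L₁ (EuclideanSpace.single (2 : Fin 3) (1 : ℝ))))),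
      y ∉ reachSet L₂ (L₂ ((haggLabel σ₂ 0 : ℝ) • barlowOffset 1) + s₂) (chainFrames (-EuclideanSpace.single (2 : Fin 3) (1 : ℝ)) L₂ v₂)) :
    ∃ (m : ℝ) (T₃ : Finset (ℤ × ℤ)) (T₂ : Finset (Fin 2 → ℤ)), 0 ≤ m ∧
      (∀ kj : ℤ × ℤ, ((σ₁ kj.1 = 1 ∧ σ₁ (kj.1 - 1) = 1) ∧ ∃ i : ℤ,
        -R₀ - 4 ≤ (L₁ (layerSite σ₁ L₁ (EuclideanSpace.single (2 : Fin 3) (1 : ℝ)) kj.1 i kj.2) + s₀) 2 ∧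
        (L₁ (layerSite σ₁ L₁ (EuclideanSpace.single (2 : Fin 3) (1 : ℝ)) kj.1 i kj.2) + s₀) 2 ≤ -R₀ - 3 ∧
        Real.sqrt ((L₁ (layerSite σ₁ L₁ (EuclideanSpace.single (2 : Fin 3) (1 : ℝ)) kj.1 i kj.2) + s₀) 0 ^ 2 +
          (L₁ (layerSite σ₁ L₁ (EuclideanSpace.single (2 : Fin 3) (1 : ℝ)) kj.1 i kj.2) + s₀) 1 ^ 2) ≤ ρ - m) → kj ∈ T₃) ∧
      (∀ t : Fin 2 → ℤ, (∃ k : ℤ,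
        h + R₀ + 3 ≤ (L₂ (vertex₂ k + ((t 0 : ℝ) • triangularVec₁ 1 + (t 1 : ℝ) • triangularVec₂ 1)) + s₂) 2 ∧
        (L₂ (vertex₂ k + ((t 0 : ℝ) • triangularVec₁ 1 + (t 1 : ℝ) • triangularVec₂ 1)) + s₂) 2 ≤ h + R₀ + 4 ∧
        Real.sqrt ((L₂ (vertex₂ k + ((t 0 : ℝ) • triangularVec₁ 1 + (t 1 : ℝ) • triangularVec₂ 1)) + s₂) 0 ^ 2 +
          (L₂ (vertex₂ k + ((t 0 : ℝ) • triangularVec₁ 1 + (t 1 : ℝ) • triangularVec₂ 1)) + s₂) 1 ^ 2) ≤ ρ - m) → t ∈ T₂) ∧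
      (T₃.card : ℝ) + T₂.card ≤
        ∑ y ∈ X.filter (fun y => (X.filter fun q => dist y q = 1).card ≠ 12 ∧ -R₀ - 2 ≤ y 2 ∧ y 2 ≤ h + R₀ + 2),
          ((12 : ℝ) - ((X.filter fun q => dist y q = 1).card : ℝ)) := by
  set e₃ : EuclideanSpace ℝ (Fin 3) := EuclideanSpace.single (2 : Fin 3) (1 : ℝ) with he₃
  have he₃i : ∀ d : EuclideanSpace ℝ (Fin 3), ⟪d, e₃⟫_ℝ = d 2 := fun d => by rw [he₃, EuclideanSpace.inner_single_right]; simp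
  have hzti : ∀ d : EuclideanSpace ℝ (Fin 3), ⟪d, -e₃⟫_ℝ = -d 2 := fun d => by rw [inner_neg_right, he₃i]
  set uv : (Fin 2 → ℤ) → EuclideanSpace ℝ (Fin 3) := fun t => (t 0 : ℝ) • triangularVec₁ 1 + (t 1 : ℝ) • triangularVec₂ 1 with huv
  -- row data of plate 1
  set w₁ : EuclideanSpace ℝ (Fin 3) := bestLayerDir L₁ e₃ with hw₁def
  have hw₁s : w₁ ∈ fccSlots := bestLayerDir_mem_fccSlots L₁ e₃
  obtain ⟨a₀, b₀, a₁, b₁, hdet₁, hw₁, hw₁'⟩ := exists_rowCoeffs L₁ e₃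
  have hs2 : (0 : ℝ) < Real.sqrt 2 / 2 := by positivity
  have hinvs : 1 / (Real.sqrt 2 / 2) ≤ 2 := by
    rw [div_le_iff₀ hs2]
    have : (1 : ℝ) ≤ Real.sqrt 2 := by
      rw [show (1 : ℝ) = Real.sqrt 1 by simp]; exact Real.sqrt_le_sqrt (by norm_num)
    linarith
  -- constants
  set δ : ℝ := min δ₂ (1 / 2) with hδ
  have hδ0 : 0 < δ := lt_min hδ₂0 (by norm_num)
  have hδle₂ : δ ≤ δ₂ := min_le_left _ _
  have hδhalf : δ ≤ 1 / 2 := min_le_right _ _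
  have hinv₂ : 1 / δ₂ ≤ 1 / δ := one_div_le_one_div_of_le hδ0 hδle₂
  have hinv2 : (2 : ℝ) ≤ 1 / δ := by
    rw [le_div_iff₀ hδ0]; linarith
  have hinv0 : 0 ≤ 1 / δ := by positivity
  set m : ℝ := 3 + 8 / 3 * (h + 4 * R₀) + 3 / δ with hm
  have hm0 : 0 ≤ m := by
    rw [hm]; have : 0 ≤ 3 / δ := by positivity
    nlinarith
  set ρw : ℝ := ρ - m with hρw
  set ρin : ℝ := ρw + 1 / δ with hρin
  have hρin₁ : ρin + 8 / 3 * (h + 4 * R₀) + 2 ≤ ρ - 1 := by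
    rw [hρin, hρw, hm]
    have : 3 / δ = 3 * (1 / δ) := by ring
    nlinarith
  have hρin₂ : ρin + 8 / 3 * (h + 4 * R₀) + ((-(h + R₀) - 2 - (-(h + R₀) - 4)) / δ₂ + 2) ≤ ρ - 1 := by
    have e : (-(h + R₀) - 2 - (-(h + R₀) - 4)) / δ₂ = 2 * (1 / δ₂) := by ring
    rw [e, hρin, hρw, hm]
    have : 3 / δ = 3 * (1 / δ) := by ring
    nlinarith
  -- unit steps of the zigzag
  have hmsn₂ : ∀ k, ‖ms₂ k‖ = 1 := by
    intro k
    rcases hσ₂ k with hk | hk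
    · rw [hms₂₁ k hk, norm_eq_one_of_mem_fccSlots hv₂]
    · rw [hms₂₂ k hk, LinearIsometryEquiv.norm_map, norm_eq_one_of_mem_fccSlots (bestCapper_nabla_slot L₂ (-e₃)).1]
  have hsite₂ : ∀ (k : ℤ) (t : Fin 2 → ℤ), vertex₂ k + uv t ∈ barlowStacking 1 (Real.sqrt (2 / 3)) σ₂ := by
    intro k t
    obtain ⟨x, y, hxy⟩ := hlayer₂ k
    rw [hxy, huv]; simp only
    rw [barlowPos_add_inplane]; exact barlowPos_mem _ _ _
  -- the window balls
  set W₁ : Finset (EuclideanSpace ℝ (Fin 3)) := P₁.filter fun q => -R₀ - 4 ≤ q 2 ∧ q 2 ≤ -R₀ - 3 ∧ Real.sqrt (q 0 ^ 2 + q 1 ^ 2) ≤ ρw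
    with hW₁
  set W₂ : Finset (EuclideanSpace ℝ (Fin 3)) := P₂.filter fun q => h + R₀ + 3 ≤ q 2 ∧ q 2 ≤ h + R₀ + 4 ∧ Real.sqrt (q 0 ^ 2 + q 1 ^ 2) ≤ ρw
    with hW₂
  have hW₁site : ∀ q ∈ W₁, ∃ k i j : ℤ, q = L₁ (barlowPos 1 (Real.sqrt (2 / 3)) σ₁ k i j) + s₀ := by
    intro q hq
    obtain ⟨hqP, -⟩ := Finset.mem_filter.1 hq
    obtain ⟨r, ⟨k, i, j, rfl⟩, hr⟩ := ((hP₁ q).1 hqP).1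
    exact ⟨k, i, j, hr.symm⟩
  have hW₂site : ∀ q ∈ W₂, ∃ k i j : ℤ, q = L₂ (barlowPos 1 (Real.sqrt (2 / 3)) σ₂ k i j) + s₂ := by
    intro q hq
    obtain ⟨hqP, -⟩ := Finset.mem_filter.1 hq
    obtain ⟨r, ⟨k, i, j, rfl⟩, hr⟩ := ((hP₂ q).1 hqP).1
    exact ⟨k, i, j, hr.symm⟩
  -- bottom rows
  obtain ⟨Tr₁, hTr₁in, hTr₁out, -⟩ := rowSet_of_sites σ₁ L₁ s₀ e₃ hdet₁ hw₁ hw₁' W₁ hW₁site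
  set T₃ : Finset (ℤ × ℤ) := Tr₁.filter fun kj => σ₁ kj.1 = 1 ∧ σ₁ (kj.1 - 1) = 1 with hT₃
  have hwin₁ : ∀ kj ∈ T₃, ∃ i : ℤ, (-R₀ - 4) ≤ ⟪L₁ (layerSite σ₁ L₁ e₃ kj.1 i kj.2) + s₀, e₃⟫_ℝ ∧
      ⟪L₁ (layerSite σ₁ L₁ e₃ kj.1 i kj.2) + s₀, e₃⟫_ℝ ≤ (-R₀ - 4) + 1 ∧
      Real.sqrt ((L₁ (layerSite σ₁ L₁ e₃ kj.1 i kj.2) + s₀) 0 ^ 2 + (L₁ (layerSite σ₁ L₁ e₃ kj.1 i kj.2) + s₀) 1 ^ 2) ≤ ρw := by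
    intro kj hkj
    obtain ⟨i, hi⟩ := hTr₁out kj (Finset.mem_filter.1 hkj).1
    obtain ⟨-, h1, h2, h3⟩ := Finset.mem_filter.1 hi
    exact ⟨i, by rw [he₃i]; exact h1, by rw [he₃i]; linarith, h3⟩
  obtain ⟨ai₁, bi₁, hfam₁⟩ := rowLineFamily_spec σ₁ L₁ s₀ e₃ hdet₁ hw₁ hw₁' hs2 hsteep₁ (-R₀ - 4) ρw T₃ hwin₁
  -- top zig lines
  obtain ⟨Tl₂, hTl₂in, hTl₂out, -⟩ := lineSet_of_sites σ₂ L₂ s₂ vertex₂ hlayer₂ W₂ hW₂site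
  have hwin₂ : ∀ t ∈ Tl₂, ∃ k : ℤ, (-(h + R₀) - 4) ≤ ⟪L₂ (vertex₂ k + uv t) + s₂, -e₃⟫_ℝ ∧ ⟪L₂ (vertex₂ k + uv t) + s₂, -e₃⟫_ℝ ≤ (-(h + R₀) - 4) + 1 ∧
      Real.sqrt ((L₂ (vertex₂ k + uv t) + s₂) 0 ^ 2 + (L₂ (vertex₂ k + uv t) + s₂) 1 ^ 2) ≤ ρw := by
    intro t ht
    obtain ⟨k, hk⟩ := hTl₂out t ht
    obtain ⟨-, h1, h2, h3⟩ := Finset.mem_filter.1 hk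
    exact ⟨k, by rw [hzti]; linarith, by rw [hzti]; linarith, h3⟩
  obtain ⟨mi₂, ai₂, bi₂, hfam₂⟩ := lineFamily_spec σ₂ L₂ s₂ (-e₃) ms₂ vertex₂ hδ₂0 hδ₂ hmsn₂ hsucc₂ hlayer₂ (-(h + R₀) - 4) ρw Tl₂ hwin₂
  -- fuel
  set N : ℕ := ⌈2 / δ⌉₊ + ⌈8 * (h + 4 * R₀) / 3⌉₊ + 2 with hN
  have hN₂ : ⌈(-(h + R₀) - 2 - (-(h + R₀) - 4)) / δ₂⌉₊ + 1 ≤ N := by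
    have e : (-(h + R₀) - 2 - (-(h + R₀) - 4)) / δ₂ = 2 / δ₂ := by ring
    rw [e, hN]
    have : ⌈2 / δ₂⌉₊ ≤ ⌈2 / δ⌉₊ := Nat.ceil_mono (by
      have : 2 / δ₂ = 2 * (1 / δ₂) := by ring
      have : 2 / δ = 2 * (1 / δ) := by ring
      nlinarith)
    omega
  have hNfuel : 8 * (h + 4 * R₀) < 3 * (N : ℝ) := by
    rw [hN]; push_cast
    have h1 := Nat.le_ceil (8 * (h + 4 * R₀) / 3)
    have h2 : (0 : ℝ) ≤ ⌈2 / δ⌉₊ := Nat.cast_nonneg _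
    linarith
  -- the two-family count
  have hcount := barlowRowZig_card_le_payers hX hsE hcert hDS hCP hσ₁ hσ₂ L₁ L₂ s₀ s₂ R₀ h ρ hR₀ hh hρ P₁ P₂ hP₁X hP₂X hcell hP₁ hP₂
    hw₁s a₀ b₀ hw₁ hsteep₁ v₂ canon₂ ms₂ hv₂ hv₂2 hsteep₂ hcanon₂₁ hcanon₂₂ hms₂₁ hms₂₂ hδ₂0 hδ₂ hoff₁ hoff₂ hdisjR
    (-R₀ - 4) (-(h + R₀) - 4) ρin (by linarith) (by linarith) (by linarith) (by linarith) hρin₁ hρin₂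
    T₃ Tl₂ (fun kj => kj.1) ai₁ bi₁ mi₂ ai₂ bi₂
    (fun kj hkj => (Finset.mem_filter.1 hkj).2)
    (fun kj hkj => (hfam₁ kj hkj).2.1) (fun kj hkj => (hfam₁ kj hkj).2.2.2.1)
    (fun kj hkj kj' hkj' heq => (hfam₁ kj hkj).2.2.2.2.2 kj' hkj' heq)
    (fun kj hkj => by have := (hfam₁ kj hkj).2.2.2.2.1; rw [hρin]; linarith)
    (fun t ht => (hfam₂ t ht).2.1) (fun t ht => (hfam₂ t ht).2.2.2.1) (fun t ht t' ht' heq => (hfam₂ t ht).2.2.2.2.2 t' ht' heq)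
    (fun t ht => by have := (hfam₂ t ht).2.2.2.2.1; rw [hρin]; linarith)
    hN₂ hNfuel
  refine ⟨m, T₃, Tl₂, hm0, fun kj ⟨hcc, i, h1, h2, h3⟩ => ?_, fun t ht => ?_, hcount⟩
  · set q := L₁ (layerSite σ₁ L₁ e₃ kj.1 i kj.2) + s₀ with hq
    have h0 : 0 ≤ q 0 ^ 2 + q 1 ^ 2 := by positivity
    have hle : Real.sqrt (q 0 ^ 2 + q 1 ^ 2) ≤ ρ := by linarith only [h3, hm0]
    have hlat2 : q 0 ^ 2 + q 1 ^ 2 ≤ ρ ^ 2 := by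
      have h7 := pow_le_pow_left₀ (Real.sqrt_nonneg _) hle 2
      rwa [Real.sq_sqrt h0] at h7
    have hqP : q ∈ P₁ := (hP₁ _).2 ⟨layerSite_mem_stacking σ₁ L₁ e₃ s₀ kj.1 i kj.2, by linarith only [h1, hR₀], by linarith only [h2], hlat2⟩
    have hqW : q ∈ W₁ := by rw [hW₁, Finset.mem_filter]; exact ⟨hqP, h1, h2, h3⟩
    rw [hT₃, Finset.mem_filter]
    exact ⟨hTr₁in kj ⟨i, hqW⟩, hcc⟩
  · obtain ⟨k, h1', h2', h3'⟩ := ht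
    have h1 : h + R₀ + 3 ≤ (L₂ (vertex₂ k + uv t) + s₂) 2 := h1'
    have h2 : (L₂ (vertex₂ k + uv t) + s₂) 2 ≤ h + R₀ + 4 := h2'
    have h3 : Real.sqrt ((L₂ (vertex₂ k + uv t) + s₂) 0 ^ 2 + (L₂ (vertex₂ k + uv t) + s₂) 1 ^ 2) ≤ ρ - m := h3'
    have h0 : 0 ≤ (L₂ (vertex₂ k + uv t) + s₂) 0 ^ 2 + (L₂ (vertex₂ k + uv t) + s₂) 1 ^ 2 := by positivity
    have hle : Real.sqrt ((L₂ (vertex₂ k + uv t) + s₂) 0 ^ 2 + (L₂ (vertex₂ k + uv t) + s₂) 1 ^ 2) ≤ ρ := by linarith only [h3, hm0]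
    have hlat2 : (L₂ (vertex₂ k + uv t) + s₂) 0 ^ 2 + (L₂ (vertex₂ k + uv t) + s₂) 1 ^ 2 ≤ ρ ^ 2 := by
      have h7 := pow_le_pow_left₀ (Real.sqrt_nonneg _) hle 2
      rwa [Real.sq_sqrt h0] at h7
    have hstk : L₂ (vertex₂ k + uv t) + s₂ ∈ stacking L₂ s₂ σ₂ := by
      unfold stacking; exact Set.mem_image_of_mem (fun r => L₂ r + s₂) (hsite₂ k t)
    have hqP : L₂ (vertex₂ k + uv t) + s₂ ∈ P₂ := (hP₂ _).2 ⟨hstk, by linarith only [h1], by linarith only [h2, hR₀], hlat2⟩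
    have hqW : L₂ (vertex₂ k + uv t) + s₂ ∈ W₂ := by
      rw [hW₂, Finset.mem_filter]; exact ⟨hqP, h1, h2, by rw [hρw]; exact h3⟩
    exact hTl₂in t ⟨k, hqW⟩

end Summit.Ventures.Crystal3D.Theorems

end
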